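import Mathlib
import Summits.CriticalPhenomena.PercolationContinuityZ3.Theorems.PercNearOneGluingNoHeavyLowerTailFatMinorityEdgeCore
import HarnessLib

/-!
# `NoHeavyLowerTail` (stmt-CriticalPhenomena-4575), line fat-minority-linear — the SLACK EDGE LEMMA (T4 / (B1)):
# bootstrap and final form (route task `nh-dp-fatminority`, gen 11; PROOF-UT4-upto3ports.md (B1), PROOF-INDUCTION-modulo-C2.md T4)

Notation of `…FatMinorityEdgeCore.lean`: `e = s(o,a)`, `p = w(e)`, `μ₀ = μ_{w[e↦0]}`, `μ₁ = μ_{w[e↦1]}`,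
`piv t = μ₁(t↔b) − μ₀(t↔b)`, `m ≤ min_{v∈A} μ(v↔b)`, `σ = μ(a↔b) − m`.

`slackEdgeLemma`: if QUT4 holds for the star of `o` with ports `A ∖ {a}` in the law `μ₀` (for every threshold dominating
the gaps `μ₀(a↔b) − μ₀(v↔b)`; this is THEOREM A/B of the notes, resp. the induction hypothesis, one port down), then for
every vertex `c ≠ o`:  `(1 − p)·(piv c − piv a) ≤ σ`.  For `m = min_v μ(v↔b)` and `a` the least reliable port this is the
EDGE LEMMA "the edge from the observer to its least reliable port is more pivotal for that port than for any other vertex";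
in general it is the hypothesis `hedge` of `threshold_bookkeeping` (T5) and gives `E_z ≥ 0` in `upsetStar_caseI_step`.
Proof: the bootstrap of (B1) — with `Pmax = max_{c ≠ o} [(1−p)(piv c − piv a) − σ]⁺`, `slackEdge_core` gives
`(1−p)(piv c − piv a) − σ ≤ p·Pmax` for every `c`, hence `Pmax ≤ p·Pmax`, so `Pmax = 0` as `p < 1` (and `p = 1` is trivial).  No definitions.
-/

namespace Summit.CriticalPhenomena.PercolationContinuityZ3.Theorems

open MeasureTheory Set
open Literature.Probability.LatticeModels (prodBernoulli)
open Literature.Probability.Percolation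

noncomputable section
open scoped Classical

variable {n : ℕ}

/-- **Slack edge lemma (T4).**  See the module docstring: QUT4 one port down (`hIH`) implies
`(1 − p)·(piv c − piv a) ≤ μ(a↔b) − m` for every vertex `c ≠ o` and every `m ≤ min_{v∈A} μ(v↔b)`.
[cite: KozmaNitzan2024, Lemma 4 p. 9 (two-endpoint qualitative form); VandenbergHaggstromKahn2005, Thm. 1.4/1.5 (p. 7); statement and bootstrap: route notes gen 8 §4b (B1)] -/
theorem slackEdgeLemma (w : Sym2 (Fin n) → unitInterval) (A : Finset (Fin n)) (o a b c : Fin n)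
    (hoA : o ∉ A) (haA : a ∈ A) (hco : c ≠ o)
    (hiso : ∀ u, u ≠ o → u ∉ A → w s(o, u) = 0) (hloop : w s(o, o) = 0)
    (m : ℝ) (hm : ∀ v ∈ A, m ≤ (prodBernoulli w).real (openConn v b))
    (hIH : ∀ t' : ℝ, 0 ≤ t' →
      (∀ v ∈ A.erase a, (prodBernoulli (Function.update w s(o, a) 0)).real (openConn a b) -
          (prodBernoulli (Function.update w s(o, a) 0)).real (openConn v b) ≤ t') →
      ∀ 𝒰 : Finset (Finset (Fin n)), 𝒰 ⊆ (A.erase a).powerset → ∅ ∉ 𝒰 →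
        (∀ B ∈ 𝒰, ∀ B' ∈ (A.erase a).powerset, B ⊆ B' → B' ∈ 𝒰) →
        (prodBernoulli (Function.update w s(o, a) 0)).real
              (openConn a b ∩ {ω | ∃ B ∈ 𝒰, ∀ u ∈ B, s(o, u) ∈ ω}) -
            (prodBernoulli (Function.update w s(o, a) 0)).real
              (openConn o b ∩ {ω | ∃ B ∈ 𝒰, ∀ u ∈ B, s(o, u) ∈ ω}) ≤
          t' * (prodBernoulli (Function.update w s(o, a) 0)).real {ω | ∃ B ∈ 𝒰, ∀ u ∈ B, s(o, u) ∈ ω}) :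
    (1 - (w s(o, a) : ℝ)) *
        (((prodBernoulli (Function.update w s(o, a) 1)).real (openConn c b) -
            (prodBernoulli (Function.update w s(o, a) 0)).real (openConn c b)) -
          ((prodBernoulli (Function.update w s(o, a) 1)).real (openConn a b) -
            (prodBernoulli (Function.update w s(o, a) 0)).real (openConn a b))) ≤
      (prodBernoulli w).real (openConn a b) - m := by
  have hao : a ≠ o := fun h => hoA (h ▸ haA)
  have hσ0 : 0 ≤ (prodBernoulli w).real (openConn a b) - m := by linarith [hm a haA]
  have hp0 : 0 ≤ (w s(o, a) : ℝ) := (w s(o, a)).2.1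
  have hple : (w s(o, a) : ℝ) ≤ 1 := (w s(o, a)).2.2
  by_cases hp1 : (w s(o, a) : ℝ) < 1
  swap
  · have hp : (w s(o, a) : ℝ) = 1 := le_antisymm hple (not_lt.1 hp1)
    rw [hp, sub_self, zero_mul]
    exact hσ0
  -- the slack functional and its maximiser over the vertices `≠ o`
  set S : Fin n → ℝ := fun c' =>
    (1 - (w s(o, a) : ℝ)) *
        (((prodBernoulli (Function.update w s(o, a) 1)).real (openConn c' b) -
            (prodBernoulli (Function.update w s(o, a) 0)).real (openConn c' b)) -
          ((prodBernoulli (Function.update w s(o, a) 1)).real (openConn a b) -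
            (prodBernoulli (Function.update w s(o, a) 0)).real (openConn a b))) -
      ((prodBernoulli w).real (openConn a b) - m) with hS
  have hne : (Finset.univ.erase o : Finset (Fin n)).Nonempty := ⟨a, Finset.mem_erase.2 ⟨hao, Finset.mem_univ a⟩⟩
  obtain ⟨cs, hcs, hmax⟩ := Finset.exists_max_image (Finset.univ.erase o) S hne
  have hcso : cs ≠ o := (Finset.mem_erase.1 hcs).1
  set Pmax : ℝ := max 0 (S cs) with hPmax
  have hPmax0 : 0 ≤ Pmax := le_max_left _ _
  have hbound : ∀ c', c' ≠ o → S c' ≤ Pmax := fun c' hc' =>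
    (hmax c' (Finset.mem_erase.2 ⟨hc', Finset.mem_univ c'⟩)).trans (le_max_right _ _)
  have hports : ∀ v ∈ A, v ≠ a →
      (1 - (w s(o, a) : ℝ)) *
          (((prodBernoulli (Function.update w s(o, a) 1)).real (openConn v b) -
              (prodBernoulli (Function.update w s(o, a) 0)).real (openConn v b)) -
            ((prodBernoulli (Function.update w s(o, a) 1)).real (openConn a b) -
              (prodBernoulli (Function.update w s(o, a) 0)).real (openConn a b))) -
        ((prodBernoulli w).real (openConn a b) - m) ≤ Pmax := by
    intro v hvA hva
    have hvo : v ≠ o := fun h => hoA (h ▸ hvA)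
    simpa only [hS] using hbound v hvo
  have hcore : ∀ c', c' ≠ o → S c' ≤ (w s(o, a) : ℝ) * Pmax := by
    intro c' hc'
    have h := slackEdge_core w A o a b c' hoA haA hc' hiso hloop m Pmax hm hPmax0 hp1 hports hIH
    simp only [hS]
    linarith
  -- bootstrap: `Pmax ≤ p Pmax` forces `Pmax = 0`
  have hPmaxle : Pmax ≤ (w s(o, a) : ℝ) * Pmax := by
    simp only [hPmax]
    refine max_le ?_ ?_
    · exact le_trans (le_refl 0) (mul_nonneg hp0 hPmax0)
    · exact (hcore cs hcso).trans (le_refl _)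
  have hPmaxz : Pmax = 0 := by
    refine le_antisymm ?_ hPmax0
    nlinarith [hPmaxle, hp1, hPmax0]
  have h := hcore c hco
  rw [hPmaxz, mul_zero] at h
  simp only [hS] at h
  linarith

end

end Summit.CriticalPhenomena.PercolationContinuityZ3.Theorems
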